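import Summits.Langlands.Langlands.Theorems.AbelianSurfaceSerreSerreGSp4SurjectiveStubLiftExists
import HarnessLib

/-!
# Route `AbelianSurfaceSerre`, crux `SerreGSp4Surjective` (stmt-Langlands-17765), line `singer-type-evaporation`:
# the registered stub `stub_liftExists` (skeleton v9.1)

The existence of the crystalline-ordinary symplectic `p`-adic lift (`OrdinaryLift`) of a full-image, ordinary
`p`-distinguished `ρ̄ : Γ_ℚ → GL₄(𝔽_p)`, CONDITIONAL on the two vendored named facts that are its antecedents:
the LOCAL lemma `Yamauchi2020_sec941_ordinarySymplecticLift_rat` (p171175; for `ε̄`-adjacent residual characters the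
symplectic ordinary local lift is printed only as a sketch — caveat in that file's docstring; the generic case is the
rigorous `GeeGeraghty2012_lem767_ordinarySymplecticLift_rat`, p170640, see `stub_liftExists_generic_of`) and the GLOBAL
theorem `FKP2021_thmA_ordinaryCrystallineLift_GSp4_rat` (p171174; Fakhruddin–Khare–Patrikis 2021 Thm A for `GSp₄/ℚ`
with the crystalline-ordinary component at `p`).  The proof is `stub_liftExists_of` of the landed helper file
`AbelianSurfaceSerreSerreGSp4SurjectiveStubLiftExists.lean` (p171557, wave 2 of lead c1).
-/

set_option linter.dupNamespace false -- `Summit.Langlands.Langlands` is the mandated namespace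

namespace Summit.Langlands.Langlands.Cruxes.SerreGSp4Surjective.SingerTypeEvaporation

open Literature.NumberTheory.GaloisRepresentations Literature.NumberTheory.Automorphic

/-- **Stub 2/7 `stub_liftExists` (registered signature, verbatim; skeleton v9.1).**  For `p ≥ p₁` every `ρ̄`
with full symplectic image (H1) and ordinary `p`-distinguished local shape (H2) admits an `OrdinaryLift`
(symplectic-`ε⁻¹`, crystalline, Greenberg-ordinary with integer exponents, reducing to `ρ̄`), conditional on the
local symplectic ordinary lift lemma and on FKP 2021 Thm A for `GSp₄/ℚ` (the two antecedents).
[cite: FakhruddinKharePatrikis2021, Thm. A] -/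
theorem stub_liftExists :
    Yamauchi2020_sec941_ordinarySymplecticLift_rat → FKP2021_thmA_ordinaryCrystallineLift_GSp4_rat →
    ∃ p₁ : ℕ, ∀ (p : ℕ) [Fact p.Prime], p₁ ≤ p → ∀ ρ : FramedGaloisRep ℚ (ZMod p) 4,
      FullSymplecticImage p ρ → OrdinaryDistinguishedAt p ρ → Nonempty (OrdinaryLift p ρ) :=
  fun hL hG => stub_liftExists_of hL hG

end Summit.Langlands.Langlands.Cruxes.SerreGSp4Surjective.SingerTypeEvaporation
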